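import Literature.MathematicalPhysics.QuantumFieldTheory.Balaban1983to89.NodeOLettersOfWalks
import Literature.MathematicalPhysics.QuantumFieldTheory.Balaban1983to89.B13LocalKernelWalks

/-!
# `Balaban1983to89.NodeOLettersOfWalksWitness` — VOLUME-UNIFORM, σ- AND u-DEPENDENT MODEL WITNESSES, WITH NON-EMPTY
# σ-CARRYING WALK FAMILIES, FOR THE HYPOTHESIS LISTS OF `NodeOLettersOfWalks.termLetters_of_walks` AND `…_of_walks₂`

statement-level bookkeeping over published theorems with citation tags; finite-matrix MODELS on the unit torus, kernel-
checked; nothing here is a claim about the Yang–Mills mass gap.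

Cell `pub-ymgap`, D-0062 Track A, node N10 = [Balaban1988RG2Cluster] Lemmas 1–3; seat `dag-n10-b` g4 (v1.0.1 g5: docstrings only).  WHY.  The capstone
`NodeOLettersOfWalks.termLetters_of_walks` (p432164) reduces NODE O's `TermLetters` of a (2.14)-term to [B9]-shaped data:
three `JointWalkExpansion`s (local factor `L`, full precision `P`, term precision `A2`) + two accretivity constants + the
(2.7) reading `G2 = L·P^{−1/2}` + volume sums + far-ness + rate bookkeeping.  The cell's discharge referee (READ-312, A2)
asked for *"the VOLUME-UNIFORM model witness with SX ≠ ∅"* of that list (its only inhabitant on record being constant kernels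
with `SX = ∅`, where the letter (L2) is vacuous); the memo cell `ym-nodeO-ideate` (P3 g24) then LOCATED a slot guard: ONE
volume constant at ONE rate serves both the square root's Combes–Thomas condition and the rate-`η` sums, so the list as
typed is instantiable only by precisions decaying at a LARGE torus rate with an unchanged constant — whence the two-constant
edition `termLetters_of_walks₂` (v1.1 of the capstone).  This file inhabits BOTH lists, non-degenerately, on every torus.

THE MODEL (§4–§6) on the site torus `UT Nf` (any `ν`, any side lengths), for a non-empty σ-region `X`, an s-parameter `j₀`,
ONE bounded functional `ℓ` of the configuration space `E`, a radius `R`: rows `Λ` = the sites (`locΛ = id`), extra columns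
`C₀` = a second copy (`locN = Sum.elim id id`); one-step families of shape (1.11) with coefficient `λ(1 + ℓ(u))` (GENUINE
holomorphic `u`-dependence) and s-monomial `σ_{j₀}` exactly on the terms anchored in `X` (GENUINE σ-dependence at the
reference configuration; closed form `diagTerms_kernel`): `hopTerms` (forward nearest-neighbour hopping between embedded
copies of the sites, the pattern of `B13LocalKernelWalks.hopping`) and `diagTerms` (range `0`); precisions
`massLocal μ H = μ·1 + H(σ,u)`; the `TermKernels` record `modelKernels` with `G2 := L·invSqrt P` (the (2.7) reading `hG2`
by `rfl`) for the hopping local factor `L` and ANY full precision `P` real at the reference point, `A2 = μ_A·1 + D_A`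
diagonal, reference data REAL (`im_invSqrt_map_ofReal`: `invSqrt` of a real matrix is real, no symmetry needed;
`hG0`, `hC0`, `hC` PROVED, `C = refDiag_A⁻¹` positive definite).
THE HYPOTHESES, DISCHARGED BY NAME: the expansions by `B13LocalKernelWalks.jointWalkExpansion_local_c0` ([B9] Thm 3.10 at walk
length ≤ 1, torus-uniform by [B6] (2.61) `rowSum_torus`) and `B13JointWalkExpansion.jointWalkExpansion_const` (the mass
`μ·1`), added through the same `X` (§1, a `private` Literature-side twin of Gaps' `D4WalkSum.jointWalkExpansion_add_same`, not
importable here) — σ-CARRYING SUB-FAMILIES NON-EMPTY (`sigmaCarrying_model_nonempty`); accretivity by print's p. 15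
*"perturbative argument"* = `B13Sqrt27Accretive.accretive_of_coercive_add` (`μ·1` coercive, row∕column sums of `H(σ,u)` from
its OWN walk majorants × volume sums: `accretive_massLocal`, `m = μ − K̄_H c_V`); volume constants `c_V(η) = 2c₀(1,η)^ν`;
far-ness `R_σ = 0`; the rate inequalities by `norm_num ∕ linarith ∕ field_simp`.
THE THEOREMS.  `termLetters_model` — WITNESS 1, the list AS TYPED (single `c_V`): full precision `μ_P·1 + D_P` DIAGONAL, torus
rate `κ_P = 12 + 24K̄_Pc_V∕m_P` (admissible only because a range-`0` family decays at every rate with the same constant —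
the located loophole), rates `(κ, θ′, ρ_L, ρ_E, ρ₀, ρ′, η) = (3,2,2,2,2,1,1)`.  `termLetters_model₂` — WITNESS 2, the
two-constant list: full precision `μ_P·1 + H_P` with `H_P` nearest-neighbour HOPPING (off-diagonal entries ≍ couplings),
torus rate `κ_P = 1`, Combes–Thomas rate `κ = m_P∕(8K̄_Pc_V(½))`, rates `⅔κ, ⅓κ`, volume constant `c_V(κ∕3)`.  DEGENERACY (READ-331,
v1.0.1): this one-directional `H_P = F` has `F² = 0`, `L·F = 0`, so `G2 = μ_P^{−1/2}L` — the Combes–Thomas mechanism runs in the hypothesis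
arithmetic only; symmetric non-collapsing witness: `NodeOLettersOfWalksWitnessSym.termLetters_model₃`; `modelKernels` needs `P` REAL at `(0,0)`
only (print's `(U,0)`-precision is symmetric positive, p. 15; WITNESS 1∕2's `P` is real, WITNESS 3's real symmetric).  Both under
the torus-INDEPENDENT smallness `m_P, m_A > 0` of the couplings (`mAcc_eq`: `m = μ − |λ|·Q(ν, κ₁, ‖ℓ‖R)`, so NON-ZERO couplings
qualify), both with covariance rate `κ_C > 0` and every constant an explicit function of `(ν, κ₁, couplings, masses, ‖ℓ‖R)` —
NO DEPENDENCE ON `Nf` ([B9] p. 416: *"The constant O(1) depends on d and L only"*).  Downstream unchanged: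
`NodeOLetters.termWalkData_of_letters` ⟹ `TermWalkData` ⟹ L17a ∧ L16a ⟹ (2.26).
DEDUP.  Neighbouring tree witnesses are for other producers ∕ layers (`jointWalkExpansion_const` — `SX = ∅`;
`B13LocalKernelWalks.jointWalkExpansion_hopping` — one family; `B13TermWalkDataOneTorus.termWalkData_free∕_junk`; Gaps
`D4WalkModelFull.termWalkData` — BalabanUV venue; `B13Sqrt27AccretiveWitness` — no σ, no walks).
CITATIONS.  [Balaban1988RG2Cluster] (1.11) p. 5, p. 13, (2.7) p. 13, p. 15 (*"The general case is handled by a perturbative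
argument"*; real operators at `(U,0)`), (2.14)–(2.16) pp. 15–16; [Balaban1985BackgroundPropagators] (3.93) p. 410, Thm 3.10
(3.107)–(3.108) p. 416, (3.154) p. 427; [Balaban1984PropagatorsII] Lemma 2.1 (2.61) p. 234.
HONEST FRAMING: MODELS — finite matrices on the unit torus; they certify that the hypothesis SHAPES of the two capstones are
jointly inhabited, non-degenerately and volume-uniformly, and NOTHING ELSE: whether Bałaban's `C*Δ_k(σ)C_{Z₀ᶜ}`,
`C*Δ_k(σ,𝐔,𝐉)C`, `Δ^{(k)}(Z₀,σ)` admit such expansions ∕ accretivity with k-uniform constants at complex backgrounds is the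
in-edge's ([13] = N06 ∕ GAPS G-B9-10) and the NODE 00 pin's content, untouched.  Count-neutral Track-A side landing; NOT a
discharge of N10; NOT NODE O; nothing continuum ∕ ℝ⁴ ∕ OS ∕ mass-gap ∕ Clay.  0 `sorry`; MODEL `def`s only, no instance.
-/

noncomputable section

namespace Literature.MathematicalPhysics.QuantumFieldTheory.Balaban1983to89.NodeOLettersOfWalksWitness

open Metric Set Finset
open scoped Matrix
open Literature.MathematicalPhysics.QuantumFieldTheory.Balaban1983to89
open Literature.MathematicalPhysics.QuantumFieldTheory.Balaban1983to89.B9SectDWalk (Through MajSumLe)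
open Literature.MathematicalPhysics.QuantumFieldTheory.Balaban1983to89.B9Thm34Ext (toB6)
open Literature.MathematicalPhysics.QuantumFieldTheory.Balaban1983to89.B9Thm37GlueTorus
  (torusGeom tdist1 tdist1_nonneg tdist1_triangle tdist1_self tdist1_comm)
open Literature.MathematicalPhysics.QuantumFieldTheory.Balaban1983to89.TreeLengthTorus (TPt)
open Literature.MathematicalPhysics.QuantumFieldTheory.Balaban1983to89.B5TorusCover (UT)
open Literature.MathematicalPhysics.QuantumFieldTheory.Balaban1983to89.B11SectG (RowSum)
open Literature.MathematicalPhysics.QuantumFieldTheory.Balaban1983to89.B13JointWalkExpansion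
  (JointWalkExpansion jointWalkExpansion_const)
open Literature.MathematicalPhysics.QuantumFieldTheory.Balaban1983to89.B13LocalKernelWalks (LocalTerms rowSum_torus)
open Literature.MathematicalPhysics.QuantumFieldTheory.Balaban1983to89.NodeOLetters (distX TermLetters)
open Literature.MathematicalPhysics.QuantumFieldTheory.Balaban1983to89.NodeOLettersOfWalks (termLetters_of_walks)
open Literature.MathematicalPhysics.QuantumFieldTheory.Balaban1983to89.B13Sqrt27Accretive
  (invSqrt invSqrt_map_ofReal accretive_of_coercive_add)

variable {d N' : ℕ} {ν : ℕ} {Nf : Fin ν → ℕ} [∀ i, NeZero (Nf i)]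
variable {E : Type*} [NormedAddCommGroup E] [NormedSpace ℂ E]

/-! ## §1. Two joint walk expansions through the same region add (Literature-side twin of Gaps' `D4WalkSum`) -/

section Add

variable {p n : Type} {c : B13.Consts} {locp : p → UT Nf} {locn : n → UT Nf} {X : Finset (UT Nf)} {R ε kap : ℝ}
variable {K₁ K₂ : (TPt d N' → ℂ) → E → Matrix p n ℂ}
variable {W₁ W₂ : Type} {T₁ : W₁ → (TPt d N' → ℂ) → E → Matrix p n ℂ} {T₂ : W₂ → (TPt d N' → ℂ) → E → Matrix p n ℂ}
variable {SX₁ : Set W₁} {SX₂ : Set W₂} {A₁ : W₁ → ℝ} {A₂ : W₂ → ℝ}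
variable {D₁ : W₁ → UT Nf → UT Nf → ℝ} {D₂ : W₂ → UT Nf → UT Nf → ℝ} {Kbar₁ Kbar₂ ρ : ℝ}

/-- Splitting a partial sum over `W₁ ⊕ W₂` (copy of Gaps' `D4WalkSum.majSumLe_sum`). [cite: Balaban1985BackgroundPropagators, (3.108) p.416] -/
private theorem majSumLe_sum {g : B6.Geometry} {M₁ : W₁ → g.Site → g.Site → ℝ} {M₂ : W₂ → g.Site → g.Site → ℝ}
    {B₁ B₂ : g.Site → g.Site → ℝ} (h₁ : MajSumLe M₁ B₁) (h₂ : MajSumLe M₂ B₂) :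
    MajSumLe (fun ω : W₁ ⊕ W₂ => Sum.elim M₁ M₂ ω) (fun a b => B₁ a b + B₂ a b) := by
  intro S a b
  rw [← Finset.toLeft_disjSum_toRight (u := S), Finset.sum_disjSum]
  exact add_le_add (h₁ S.toLeft a b) (h₂ S.toRight a b)

/-- **The sum of two joint walk expansions through the same `X` with the same rates is one** (terms on `W₁ ⊕ W₂`, data by
`Sum.elim`, constant `K̄₁ + K̄₂`) — Literature-side twin of Gaps' `D4WalkSum.jointWalkExpansion_add_same` (not importable here).
[cite: Balaban1985BackgroundPropagators, Thm 3.10 (3.107)–(3.108) p.416; Balaban1988RG2Cluster, (1.11) p.5, p.13] -/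
private theorem jointWalkExpansion_add
    (h₁ : JointWalkExpansion c locp locn K₁ X R ε kap Kbar₁ T₁ SX₁ A₁ D₁ ρ)
    (h₂ : JointWalkExpansion c locp locn K₂ X R ε kap Kbar₂ T₂ SX₂ A₂ D₂ ρ) :
    JointWalkExpansion c locp locn (fun σ u => K₁ σ u + K₂ σ u) X R ε kap (Kbar₁ + Kbar₂)
      (fun (ω : W₁ ⊕ W₂) => Sum.elim T₁ T₂ ω) {ω | Sum.elim (· ∈ SX₁) (· ∈ SX₂) ω}
      (fun ω => Sum.elim A₁ A₂ ω) (fun ω => Sum.elim D₁ D₂ ω) ρ where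
  hasSum σ hσ u hu i j := by
    rw [Matrix.add_apply]
    exact HasSum.sum (f := fun ω : W₁ ⊕ W₂ => Sum.elim T₁ T₂ ω σ u i j) (h₁.hasSum σ hσ u hu i j)
      (h₂.hasSum σ hσ u hu i j)
  termAnalytic ω σ hσ i j := by
    rcases ω with ω | ω; exacts [h₁.termAnalytic ω σ hσ i j, h₂.termAnalytic ω σ hσ i j]
  maj ω σ hσ u hu i j := by
    rcases ω with ω | ω; exacts [h₁.maj ω σ hσ u hu i j, h₂.maj ω σ hσ u hu i j]
  majSum := by
    have g := majSumLe_sum h₁.majSum h₂.majSum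
    intro S a b
    have e : ∀ ω : W₁ ⊕ W₂, Sum.elim A₁ A₂ ω * Real.exp (-((ρ - ε) * Sum.elim D₁ D₂ ω a b)) =
        Sum.elim (fun ω a b => A₁ ω * Real.exp (-((ρ - ε) * D₁ ω a b)))
          (fun ω a b => A₂ ω * Real.exp (-((ρ - ε) * D₂ ω a b))) ω a b := by
      rintro (ω | ω) <;> rfl
    calc ∑ ω ∈ S, Sum.elim A₁ A₂ ω * Real.exp (-((ρ - ε) * Sum.elim D₁ D₂ ω a b))
        = ∑ ω ∈ S, Sum.elim (fun ω a b => A₁ ω * Real.exp (-((ρ - ε) * D₁ ω a b)))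
            (fun ω a b => A₂ ω * Real.exp (-((ρ - ε) * D₂ ω a b))) ω a b := Finset.sum_congr rfl fun ω _ => e ω
      _ ≤ Kbar₁ * Real.exp (-(kap * tdist1 Nf a b)) + Kbar₂ * Real.exp (-(kap * tdist1 Nf a b)) := g S a b
      _ = (Kbar₁ + Kbar₂) * Real.exp (-(kap * tdist1 Nf a b)) := by ring
  indep ω hω σ hσ := by rcases ω with ω | ω; exacts [h₁.indep ω hω σ hσ, h₂.indep ω hω σ hσ]
  through ω hω := by rcases ω with ω | ω; exacts [h₁.through ω hω, h₂.through ω hω]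
  A_nonneg ω := by rcases ω with ω | ω; exacts [h₁.A_nonneg ω, h₂.A_nonneg ω]
  D_nonneg ω a b := by rcases ω with ω | ω; exacts [h₁.D_nonneg ω a b, h₂.D_nonneg ω a b]

end Add

/-! ## §2. The mass term `μ·1` as a one-walk expansion; accretivity of `μ·1 + H` by the perturbative argument -/

section Mass

variable {ι : Type}

/-- A one-member majorant family on `Unit`: partial sums are bounded by the member (non-negative). [folklore] -/
private theorem majSumLe_unit {g : B6.Geometry} {K Kbar : g.Site → g.Site → ℝ} (hK : ∀ a b, 0 ≤ K a b)
    (hle : ∀ a b, K a b ≤ Kbar a b) : MajSumLe (fun (_ : Unit) a b => K a b) Kbar := by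
  intro S a b
  calc ∑ _ω ∈ S, K a b ≤ ∑ _ω ∈ (Finset.univ : Finset Unit), K a b :=
        Finset.sum_le_sum_of_subset_of_nonneg (Finset.subset_univ S) fun _ _ _ => hK a b
    _ = K a b := by simp
    _ ≤ Kbar a b := hle a b

/-- **The mass term `μ·1` (`μ ≥ 0`) located by `loc` is its own one-walk joint walk expansion** through any `X` (empty
σ-carrying sub-family, amplitude `μ`, walk distance `d₁`, torus rate `κ ≤ ρ − ε`; `jointWalkExpansion_const`). [cite: Balaban1988RG2Cluster, (1.11) p.5] -/
theorem jointWalkExpansion_mass [DecidableEq ι] (c : B13.Consts) (loc : ι → UT Nf) (X : Finset (UT Nf)) {μ R ε kap ρ : ℝ}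
    (hμ : 0 ≤ μ) (hwin : kap ≤ ρ - ε) :
    JointWalkExpansion c loc loc (fun (_ : TPt d N' → ℂ) (_ : E) => (μ : ℂ) • (1 : Matrix ι ι ℂ)) X R ε kap μ
      (fun (_ : Unit) (_ : TPt d N' → ℂ) (_ : E) => (μ : ℂ) • (1 : Matrix ι ι ℂ)) (∅ : Set Unit) (fun _ => μ)
      (fun _ => tdist1 Nf) ρ := by
  refine jointWalkExpansion_const c loc loc _ X hμ (fun a b => tdist1_nonneg a b) (fun i j => ?_) ?_
  · by_cases h : i = j
    · subst h
      simp [tdist1_self, Complex.norm_real, abs_of_nonneg hμ]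
    · rw [Matrix.smul_apply, Matrix.one_apply_ne h, smul_zero, norm_zero]
      positivity
  · refine majSumLe_unit (fun a b => by positivity) (fun a b => ?_)
    exact mul_le_mul_of_nonneg_left (Real.exp_le_exp.2 (neg_le_neg
      (mul_le_mul_of_nonneg_right hwin (tdist1_nonneg a b)))) hμ

/-- `μ·1` is `μ`-coercive on real vectors. [folklore] -/
private theorem coercive_mass [Fintype ι] [DecidableEq ι] (μ : ℝ) :
    QGQInverse.Coercive (μ • (1 : Matrix ι ι ℝ)) μ := by
  intro x
  rw [Matrix.smul_mulVec, Matrix.one_mulVec, dotProduct_smul, smul_eq_mul]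

/-- The complexification of `μ·1` is `μ·1`. [folklore] -/
private theorem map_mass [DecidableEq ι] (μ : ℝ) : (μ • (1 : Matrix ι ι ℝ)).map (algebraMap ℝ ℂ) = (μ : ℂ) • (1 : Matrix ι ι ℂ) := by
  ext i j
  by_cases h : i = j
  · subst h; simp
  · simp [Matrix.one_apply_ne h]

/-- **ACCRETIVITY OF `μ·1 + H` BY THE PERTURBATIVE ARGUMENT** (print p. 15: *"The general case is handled by a perturbative
argument"*; tree: `B13Sqrt27Accretive.accretive_of_coercive_add`): if the complex perturbation `H` has absolute row and
column sums `≤ p`, then `μ·1 + H` is `(μ − p)`-accretive. [cite: Balaban1988RG2Cluster, p.15] -/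
theorem accretive_mass_add [Fintype ι] [DecidableEq ι] (μ : ℝ) {p : ℝ} (hp : 0 ≤ p) (H : Matrix ι ι ℂ) (hrow : ∀ i, ∑ j, ‖H i j‖ ≤ p)
    (hcol : ∀ j, ∑ i, ‖H i j‖ ≤ p) (v : ι → ℂ) :
    (μ - p) * ∑ i, ‖v i‖ ^ 2 ≤ (∑ i, star (v i) * (((μ : ℂ) • (1 : Matrix ι ι ℂ) + H) *ᵥ v) i).re := by
  have h := accretive_of_coercive_add (coercive_mass (ι := ι) μ) hp hrow hcol v
  rwa [map_mass] at h

/-- **Row sums of a torus-localised kernel from its majorants and a volume sum**: `‖H_{ij}‖ ≤ K̄e^{−κd₁(loc i, loc j)}`,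
`Σ_j e^{−ηd₁(loc i, loc j)} ≤ c_V` with `η ≤ κ`, `K̄ ≥ 0` ⟹ `Σ_j ‖H_{ij}‖ ≤ K̄c_V`. [cite: Balaban1984PropagatorsII, (2.61) p.234] -/
theorem rowSum_le_of_majorants [Fintype ι] (loc : ι → UT Nf) (H : Matrix ι ι ℂ) {Kbar kap η cV : ℝ} (hK : 0 ≤ Kbar)
    (hηk : η ≤ kap) (hmaj : ∀ i j, ‖H i j‖ ≤ Kbar * Real.exp (-(kap * tdist1 Nf (loc i) (loc j))))
    (hvol : ∀ i, ∑ j, Real.exp (-(η * tdist1 Nf (loc i) (loc j))) ≤ cV) (i : ι) :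
    ∑ j, ‖H i j‖ ≤ Kbar * cV := by
  calc ∑ j, ‖H i j‖ ≤ ∑ j, Kbar * Real.exp (-(η * tdist1 Nf (loc i) (loc j))) := by
        refine Finset.sum_le_sum fun j _ => (hmaj i j).trans ?_
        exact mul_le_mul_of_nonneg_left (Real.exp_le_exp.2 (neg_le_neg
          (mul_le_mul_of_nonneg_right hηk (tdist1_nonneg _ _)))) hK
    _ = Kbar * ∑ j, Real.exp (-(η * tdist1 Nf (loc i) (loc j))) := by rw [Finset.mul_sum]
    _ ≤ Kbar * cV := mul_le_mul_of_nonneg_left (hvol i) hK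

/-- The column version of `rowSum_le_of_majorants` (`d₁` is symmetric). [cite: Balaban1984PropagatorsII, (2.61) p.234] -/
theorem colSum_le_of_majorants [Fintype ι] (loc : ι → UT Nf) (H : Matrix ι ι ℂ) {Kbar kap η cV : ℝ} (hK : 0 ≤ Kbar)
    (hηk : η ≤ kap) (hmaj : ∀ i j, ‖H i j‖ ≤ Kbar * Real.exp (-(kap * tdist1 Nf (loc i) (loc j))))
    (hvol : ∀ i, ∑ j, Real.exp (-(η * tdist1 Nf (loc i) (loc j))) ≤ cV) (j : ι) :
    ∑ i, ‖H i j‖ ≤ Kbar * cV := by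
  have hmaj' : ∀ i j, ‖Hᵀ i j‖ ≤ Kbar * Real.exp (-(kap * tdist1 Nf (loc i) (loc j))) := by
    intro i j
    rw [Matrix.transpose_apply, tdist1_comm]
    exact hmaj j i
  simpa [Matrix.transpose_apply] using rowSum_le_of_majorants loc Hᵀ hK hηk hmaj' hvol j

end Mass

/-! ## §3. Volume sums on the site torus, every size ([B6] (2.61) at one scale) -/

section Volume

/-- `1 ≤ c₀(1,η)^ν` (`B6Lemma21Arith.one_le_c0`). [cite: Balaban1984PropagatorsII, Lemma 2.1 (2.61) p.234] -/
theorem one_le_c0_pow {η : ℝ} (hη : 0 < η) : (1 : ℝ) ≤ B6.c0 1 η ^ ν :=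
  one_le_pow₀ (B6Lemma21Arith.one_le_c0 (by simpa using hη))

/-- The VOLUME CONSTANT of the model at rate `η` on two located copies of the torus: `c_V(η) = 2c₀(1,η)^ν` — a function of the
dimension and the rate only ([B6] (2.61)). [cite: Balaban1984PropagatorsII, Lemma 2.1 (2.61) p.234] -/
def cVat (η : ℝ) (ν : ℕ) : ℝ := 2 * B6.c0 1 η ^ ν

/-- The volume constant at rate `1`: `c_V = 2c₀(1,1)^ν`. [cite: Balaban1984PropagatorsII, Lemma 2.1 (2.61) p.234] -/
abbrev cV (ν : ℕ) : ℝ := cVat 1 ν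

omit [∀ i, NeZero (Nf i)] in
/-- `c_V(η) ≥ 1` (`c₀ ≥ 1`). [cite: Balaban1984PropagatorsII, Lemma 2.1 (2.61) p.234] -/
theorem one_le_cVat {η : ℝ} (hη : 0 < η) : 1 ≤ cVat η ν := by
  have := one_le_c0_pow (ν := ν) hη
  unfold cVat; linarith

/-- Two located copies of the torus at rate `η` (`B13LocalKernelWalks.rowSum_torus` twice): `Σ_{k ∈ Λ ⊕ C₀} e^{−ηd₁(a, loc k)}
≤ c_V(η)` for `loc = Sum.elim id id`, rows summed, and the same with the arguments of `d₁` exchanged (columns summed).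
[cite: Balaban1984PropagatorsII, Lemma 2.1 (2.61) p.234] -/
theorem volume_two_cVat {η : ℝ} (hη : 0 < η) (a : UT Nf) :
    (∑ k : UT Nf ⊕ UT Nf, Real.exp (-(η * tdist1 Nf a (Sum.elim id id k))) ≤ cVat η ν) ∧
      (∑ l : UT Nf ⊕ UT Nf, Real.exp (-(η * tdist1 Nf (Sum.elim id id l) a)) ≤ cVat η ν) := by
  have h : ∑ k : UT Nf ⊕ UT Nf, Real.exp (-(η * tdist1 Nf a (Sum.elim id id k))) ≤ cVat η ν := by
    rw [Fintype.sum_sum_type]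
    simp only [Sum.elim_inl, Sum.elim_inr, id]
    have h : ∑ z : UT Nf, Real.exp (-(η * tdist1 Nf a z)) ≤ B6.c0 1 η ^ ν := rowSum_torus Nf hη a
    unfold cVat; linarith
  refine ⟨h, ?_⟩
  calc ∑ l : UT Nf ⊕ UT Nf, Real.exp (-(η * tdist1 Nf (Sum.elim id id l) a))
      = ∑ l : UT Nf ⊕ UT Nf, Real.exp (-(η * tdist1 Nf a (Sum.elim id id l))) :=
        Finset.sum_congr rfl fun l _ => by rw [tdist1_comm]
    _ ≤ cVat η ν := h

/-- The sites at rate `η`: `Σ_k e^{−ηd₁(a,k)} ≤ c_V(η)` (one copy is below two). [cite: Balaban1984PropagatorsII, Lemma 2.1 (2.61) p.234] -/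
theorem volume_id_cVat {η : ℝ} (hη : 0 < η) (a : UT Nf) : ∑ k : UT Nf, Real.exp (-(η * tdist1 Nf a k)) ≤ cVat η ν := by
  have h : ∑ k : UT Nf, Real.exp (-(η * tdist1 Nf a k)) ≤ B6.c0 1 η ^ ν := rowSum_torus Nf hη a
  have h1 := one_le_c0_pow (ν := ν) hη
  unfold cVat; linarith

end Volume

/-! ## §4. The model's one-step families: diagonal σ∕u-local terms, forward hopping into the second copy -/

section Data

/-- At the reference point `σ = 0` an s-monomial is `1` on the empty index set and `0` otherwise. [cite: Balaban1988RG2Cluster, (1.11) p.5] -/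
private theorem monomial_zero (J : Finset (TPt d N')) :
    (∏ j ∈ J, (0 : TPt d N' → ℂ) j) = if J = ∅ then 1 else 0 := by
  rcases J.eq_empty_or_nonempty with h | h
  · simp [h]
  · obtain ⟨j, hj⟩ := h
    rw [Finset.prod_eq_zero hj (by simp), if_neg (Finset.nonempty_iff_ne_empty.1 ⟨j, hj⟩)]

/-- A sum against the matrix-unit pattern picks the diagonal entry. [folklore] -/
private theorem sum_mul_unit {ι : Type} [Fintype ι] [DecidableEq ι] (f : ι → ℂ) (i j : ι) :
    (∑ b, f b * (if i = b ∧ j = b then (1 : ℂ) else 0)) = if i = j then f i else 0 := by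
  by_cases h : i = j
  · subst h
    simp only [and_self, mul_ite, mul_one, mul_zero, if_true]
    rw [Finset.sum_ite_eq]; simp
  · rw [if_neg h]
    refine Finset.sum_eq_zero fun b _ => ?_
    split_ifs with hb
    exacts [absurd (hb.1.trans hb.2.symm) h, by simp]

variable (Nf)

/-- MODEL. The DIAGONAL one-step family on an index type `ι` located on the site torus by `loc`: one term per index `b`
with start = end = `loc b`, entry pattern the matrix unit at `(b,b)`, coefficient `λ(1 + ℓ(u))` — affine in ONE bounded
linear functional `ℓ` of the configuration (genuine holomorphic `u`-dependence) — and the s-monomial `σ_{j₀}` exactly on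
the indices located in the σ-region `X` (genuine σ-dependence AT the reference configuration; shape (1.11)).
[cite: Balaban1988RG2Cluster, (1.11) p.5, p.13] -/
abbrev diagTerms {ι : Type} [Fintype ι] [DecidableEq ι] (loc : ι → UT Nf) (lam : ℝ) (ℓ : E →L[ℂ] ℂ)
    (X : Finset (UT Nf)) (j₀ : TPt d N') : LocalTerms d N' ν Nf ι ι E where
  B := ι
  x := loc
  y := loc
  J := fun b => if loc b ∈ X then {j₀} else ∅
  coef := fun _ u => (lam : ℂ) * (1 + ℓ u)
  M := fun b => Matrix.of fun i j => if i = b ∧ j = b then (1 : ℂ) else 0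

/-- MODEL. FORWARD NEAREST-NEIGHBOUR HOPPING between two index types carrying embedded copies of the sites (row embedding
`er`, column embedding `ec`; in the model: from the sites `Λ` — or their first copy — into the SECOND located copy of the
sites in `Λ ⊕ C₀`, locator `Sum.elim id id`): one term per (site `z`, direction `k`), `er z → ec (z + e_k)`, coefficient
`t(1 + ℓ(u))`, s-monomial `σ_{j₀}` on the terms starting in `X` — the pattern of `B13LocalKernelWalks.hopping` with a
rectangular target. [cite: Balaban1988RG2Cluster, (1.11) p.5, p.13; Balaban1985BackgroundPropagators, (3.107) p.416] -/
abbrev hopTerms {p n : Type} [DecidableEq p] [DecidableEq n] (er : UT Nf → p) (ec : UT Nf → n) (t : ℝ) (ℓ : E →L[ℂ] ℂ)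
    (X : Finset (UT Nf)) (j₀ : TPt d N') : LocalTerms d N' ν Nf p n E where
  B := UT Nf × Fin ν
  x := fun b => b.1
  y := fun b => B5Leibniz121.up b.1 b.2
  J := fun b => if b.1 ∈ X then {j₀} else ∅
  coef := fun _ u => (t : ℂ) * (1 + ℓ u)
  M := fun b => Matrix.of fun i j => if i = er b.1 ∧ j = ec (B5Leibniz121.up b.1 b.2) then (1 : ℂ) else 0

variable {Nf}

/-- The affine coefficient `λ(1 + ℓ(u))` is bounded by `|λ|(1 + ‖ℓ‖R)` on the `R`-ball. [folklore] -/
private theorem coef_bound (lam : ℝ) (ℓ : E →L[ℂ] ℂ) {R : ℝ} {u : E} (hu : u ∈ ball (0 : E) R) :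
    ‖(lam : ℂ) * (1 + ℓ u)‖ ≤ |lam| * (1 + ‖ℓ‖ * R) := by
  have hu' : ‖u‖ ≤ R := by simpa using (mem_ball_zero_iff.1 hu).le
  rw [norm_mul, Complex.norm_real, Real.norm_eq_abs]
  refine mul_le_mul_of_nonneg_left ((norm_add_le _ _).trans ?_) (abs_nonneg _)
  have : ‖ℓ u‖ ≤ ‖ℓ‖ * R := (ℓ.le_opNorm u).trans (mul_le_mul_of_nonneg_left hu' (norm_nonneg _))
  rw [norm_one]; linarith

/-- The diagonal family is LOCAL: range `0`, one s-parameter per term, `n_B` = the fibre bound of the locator, coefficient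
bound `|λ|(1 + ‖ℓ‖R)` on the `R`-ball, σ-region `X`. [cite: Balaban1988RG2Cluster, (1.11) p.5, p.13, p.15] -/
theorem diagTerms_isLocal {ι : Type} [Fintype ι] [DecidableEq ι] (c : B13.Consts) (loc : ι → UT Nf) {nB : ℕ}
    (hfib : ∀ z : UT Nf, (Finset.univ.filter fun b => loc b = z).card ≤ nB) (lam : ℝ) (ℓ : E →L[ℂ] ℂ)
    (X : Finset (UT Nf)) (j₀ : TPt d N') (R : ℝ) :
    (diagTerms (d := d) (N' := N') Nf loc lam ℓ X j₀).IsLocal c loc loc X R (|lam| * (1 + ‖ℓ‖ * R)) 0 1 nB where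
  hMle b i j := by
    simp only [Matrix.of_apply]
    split_ifs <;> simp
  hMsupp b i j h := by
    by_cases hP : i = b ∧ j = b
    · exact ⟨congrArg loc hP.1, congrArg loc hP.2⟩
    · exact (h (by simp [hP])).elim
  hcoef_an b := (differentiableOn_const _).mul (ℓ.differentiable.differentiableOn.const_add _)
  hcoef_bd b u hu := coef_bound lam ℓ hu
  hrange b := by
    show tdist1 Nf (loc b) (loc b) ≤ 0
    rw [tdist1_self]
  hJ b := by
    dsimp only
    split_ifs <;> simp
  hX b hb := by
    by_cases h : loc b ∈ X
    · exact Or.inl h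
    · simp [h] at hb
  hmult z := hfib z

/-- The hopping family is LOCAL for locators `locp`, `locn` retracting the embeddings (`locp ∘ er = id`,
`locn ∘ ec = id`): range `1` (`tdist1_up_le`), one s-parameter per term, `ν` terms per start site, coefficient bound
`|t|(1 + ‖ℓ‖R)`, σ-region `X` (cf. `B13LocalKernelWalks.hopping_isLocal`). [cite: Balaban1988RG2Cluster, (1.11) p.5, p.13, p.15] -/
theorem hopTerms_isLocal {p n : Type} [DecidableEq p] [DecidableEq n] (c : B13.Consts) {er : UT Nf → p} {ec : UT Nf → n}
    {locp : p → UT Nf} {locn : n → UT Nf} (her : ∀ z, locp (er z) = z) (hec : ∀ z, locn (ec z) = z) (t : ℝ)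
    (ℓ : E →L[ℂ] ℂ) (X : Finset (UT Nf)) (j₀ : TPt d N') (R : ℝ) :
    (hopTerms (d := d) (N' := N') Nf er ec t ℓ X j₀).IsLocal c locp locn X R (|t| * (1 + ‖ℓ‖ * R)) 1 1 ν where
  hMle b i j := by
    simp only [Matrix.of_apply]
    split_ifs <;> simp
  hMsupp b i j h := by
    by_cases hP : i = er b.1 ∧ j = ec (B5Leibniz121.up b.1 b.2)
    · exact ⟨by rw [hP.1]; exact her _, by rw [hP.2]; exact hec _⟩
    · exact (h (by simp [hP])).elim
  hcoef_an b := (differentiableOn_const _).mul (ℓ.differentiable.differentiableOn.const_add _)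
  hcoef_bd b u hu := coef_bound t ℓ hu
  hrange b := B9Thm37GlueTorus.tdist1_up_le (N := Nf) b.1 b.2
  hJ b := by
    dsimp only
    split_ifs <;> simp
  hX b hb := by
    by_cases h : b.1 ∈ X
    · exact Or.inl h
    · simp [h] at hb
  hmult z := by
    classical
    calc (Finset.univ.filter fun b : UT Nf × Fin ν => b.1 = z).card
        ≤ (Finset.image (fun μ : Fin ν => (z, μ)) Finset.univ).card := by
          refine Finset.card_le_card fun b hb => ?_
          simp only [Finset.mem_filter, Finset.mem_univ, true_and] at hb
          exact Finset.mem_image.2 ⟨b.2, Finset.mem_univ _, by rw [← hb]⟩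
      _ ≤ (Finset.univ : Finset (Fin ν)).card := Finset.card_image_le
      _ = ν := by simp

/-- **THE DIAGONAL FAMILY IN CLOSED FORM**: `D(σ,u) = diag_i((σ_{j₀} if loc i ∈ X, else 1)·λ(1 + ℓ(u)))` — the kernel
DEPENDS on `σ` exactly at the indices located in the σ-region and on `u` through `ℓ` everywhere (λ ≠ 0): the witness is
NOT the σ-∕u-constant degenerate case. [cite: Balaban1988RG2Cluster, (1.11) p.5, p.13] -/
theorem diagTerms_kernel {ι : Type} [Fintype ι] [DecidableEq ι] (loc : ι → UT Nf) (lam : ℝ) (ℓ : E →L[ℂ] ℂ)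
    (X : Finset (UT Nf)) (j₀ : TPt d N') (σ : TPt d N' → ℂ) (u : E) :
    (diagTerms (d := d) (N' := N') Nf loc lam ℓ X j₀).kernel σ u =
      Matrix.diagonal fun i => (if loc i ∈ X then σ j₀ else 1) * ((lam : ℂ) * (1 + ℓ u)) := by
  ext i j
  rw [LocalTerms.kernel_apply]
  simp only [LocalTerms.term_apply]
  have hs : ∀ b : ι, (∏ j ∈ (diagTerms (d := d) (N' := N') (E := E) Nf loc lam ℓ X j₀).J b, σ j) *
      (diagTerms (d := d) (N' := N') Nf loc lam ℓ X j₀).coef b u *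
      (diagTerms (d := d) (N' := N') Nf loc lam ℓ X j₀).M b i j =
      ((if loc b ∈ X then σ j₀ else 1) * ((lam : ℂ) * (1 + ℓ u))) * (if i = b ∧ j = b then (1 : ℂ) else 0) := by
    intro b
    simp only [Matrix.of_apply]
    by_cases h : loc b ∈ X <;> simp [h]
  refine (Finset.sum_congr rfl fun b _ => hs b).trans ?_
  refine (sum_mul_unit (fun b => (if loc b ∈ X then σ j₀ else 1) * ((lam : ℂ) * (1 + ℓ u))) i j).trans ?_
  by_cases h : i = j
  · subst h; simp
  · simp [h]

/-- **The diagonal family at the reference point** `(σ,u) = (0,0)`: the σ-carrying terms (indices located in `X`) vanish,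
the others contribute `λ` on the diagonal. [cite: Balaban1988RG2Cluster, (1.11) p.5, p.13] -/
theorem diagTerms_kernel_zero {ι : Type} [Fintype ι] [DecidableEq ι] (loc : ι → UT Nf) (lam : ℝ) (ℓ : E →L[ℂ] ℂ)
    (X : Finset (UT Nf)) (j₀ : TPt d N') :
    (diagTerms (d := d) (N' := N') Nf loc lam ℓ X j₀).kernel 0 0 =
      Matrix.diagonal fun i => if loc i ∈ X then (0 : ℂ) else (lam : ℂ) := by
  rw [diagTerms_kernel]
  congr 1
  funext i
  by_cases h : loc i ∈ X <;> simp [h]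

/-- Every term of the hopping family is REAL at the reference point. [cite: Balaban1988RG2Cluster, (1.11) p.5, p.15] -/
private theorem im_hop_term_zero {p n : Type} [DecidableEq p] [DecidableEq n] (er : UT Nf → p) (ec : UT Nf → n)
    (t : ℝ) (ℓ : E →L[ℂ] ℂ) (X : Finset (UT Nf)) (j₀ : TPt d N') (b : UT Nf × Fin ν) (i : p) (k : n) :
    ((hopTerms (d := d) (N' := N') Nf er ec t ℓ X j₀).term b 0 0 i k).im = 0 := by
  rw [LocalTerms.term_apply]
  have h1 : (∏ j ∈ (hopTerms (d := d) (N' := N') (E := E) Nf er ec t ℓ X j₀).J b, (0 : TPt d N' → ℂ) j).im = 0 := by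
    rw [monomial_zero]
    split_ifs <;> simp
  have h2 : ((hopTerms (d := d) (N' := N') Nf er ec t ℓ X j₀).coef b (0 : E)).im = 0 := by
    simp
  have h3 : ((hopTerms (d := d) (N' := N') (E := E) Nf er ec t ℓ X j₀).M b i k).im = 0 := by
    simp only [Matrix.of_apply]
    split_ifs <;> simp
  rw [Complex.mul_im, Complex.mul_im, h1, h2, h3]
  ring

/-- **The hopping kernel is REAL at the reference point** (print p. 15: at `(U,0)` the operators are symmetric ∕ real).
[cite: Balaban1988RG2Cluster, p.15] -/
theorem im_hop_kernel_zero {p n : Type} [DecidableEq p] [DecidableEq n] (er : UT Nf → p) (ec : UT Nf → n) (t : ℝ)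
    (ℓ : E →L[ℂ] ℂ) (X : Finset (UT Nf)) (j₀ : TPt d N') (i : p) (k : n) :
    ((hopTerms (d := d) (N' := N') Nf er ec t ℓ X j₀).kernel 0 0 i k).im = 0 := by
  rw [LocalTerms.kernel_apply, Complex.im_sum]
  exact Finset.sum_eq_zero fun b _ => im_hop_term_zero er ec t ℓ X j₀ b i k

end Data

/-! ## §5. Model precisions `μ·1 + H(σ,u)`: walk expansion, accretivity, reference value -/

section Precisions

/-- The MAJORANT CONSTANT `K̄ = λ′e^{κ₁}e^{ρ_w r}·n_B·c₀(1,1)^ν` of a one-step family with coefficient bound `λ′`, range `r`, one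
s-parameter per term and `n_B` terms per site, at walk rate `ρ_w` ((3.108) summed with (2.61) at rate `1`; no dependence
on the torus). [cite: Balaban1985BackgroundPropagators, (3.108) p.416; Balaban1984PropagatorsII, (2.61) p.234] -/
def kbarLoc (c : B13.Consts) (lam' r ρw : ℝ) (nB ν : ℕ) : ℝ :=
  lam' * Real.exp (c.κ₁ * (1 : ℕ)) * Real.exp (ρw * r) * (nB * B6.c0 1 1 ^ ν)

/-- `K̄_loc ≥ 0` for `λ′ ≥ 0`. [cite: Balaban1985BackgroundPropagators, (3.108) p.416] -/
theorem kbarLoc_nonneg (c : B13.Consts) {lam' : ℝ} (h : 0 ≤ lam') (r ρw : ℝ) (nB ν : ℕ) : 0 ≤ kbarLoc c lam' r ρw nB ν := by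
  unfold kbarLoc
  have := one_le_c0_pow (ν := ν) one_pos
  positivity

/-- `K̄_loc` dominates the coefficient bound: `λ′ ≤ K̄_loc·c_V` (`n_B ≥ 1`, `κ₁ ≥ 0`, `ρ_w r ≥ 0`). [cite: Balaban1984PropagatorsII, Lemma 2.1 (2.61) p.234] -/
theorem le_kbarLoc_mul_cV (c : B13.Consts) (hκ₁ : 0 ≤ c.κ₁) {lam' r ρw : ℝ} (h : 0 ≤ lam') (hr : 0 ≤ ρw * r) {nB : ℕ}
    (hnB : 1 ≤ nB) (ν : ℕ) : lam' ≤ kbarLoc c lam' r ρw nB ν * cV ν := by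
  have h1 : 1 ≤ Real.exp (c.κ₁ * (1 : ℕ)) := Real.one_le_exp (by simpa using hκ₁)
  have h1' : 1 ≤ Real.exp (ρw * r) := Real.one_le_exp hr
  have h2 : (1 : ℝ) ≤ B6.c0 1 1 ^ ν := one_le_c0_pow one_pos
  have h3 : (1 : ℝ) ≤ nB := by exact_mod_cast hnB
  have h4 : 1 ≤ cV ν := one_le_cVat one_pos
  unfold kbarLoc
  calc lam' = lam' * 1 * 1 * (1 * 1) * 1 := by ring
    _ ≤ lam' * Real.exp (c.κ₁ * (1 : ℕ)) * Real.exp (ρw * r) * (nB * B6.c0 1 1 ^ ν) * cV ν := by gcongr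

variable (Nf)

/-- MODEL. A MODEL PRECISION `μ·1 + H(σ,u)`: mass `μ` plus a one-step family `H`. [cite: Balaban1988RG2Cluster, (1.11) p.5, (2.7) p.13, p.15] -/
abbrev massLocal {ι : Type} [Fintype ι] [DecidableEq ι] (μ : ℝ) (H : LocalTerms d N' ν Nf ι ι E) :
    (TPt d N' → ℂ) → E → Matrix ι ι ℂ :=
  fun σ u => (μ : ℂ) • (1 : Matrix ι ι ℂ) + H.kernel σ u

/-- MODEL. The REAL REFERENCE VALUE of the DIAGONAL model precision `μ·1 + D(σ,u)`: `diag(μ + λ·[loc i ∉ X])` (the σ-carrying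
diagonal terms vanish at `σ = 0`, the configuration term at `u = 0`). [cite: Balaban1988RG2Cluster, p.15] -/
def refDiag {ι : Type} [DecidableEq ι] (loc : ι → UT Nf) (μ lam : ℝ) (X : Finset (UT Nf)) : Matrix ι ι ℝ :=
  Matrix.diagonal fun i => μ + if loc i ∈ X then 0 else lam

variable {Nf}

/-- **JOINT WALK EXPANSION OF A MODEL PRECISION `μ·1 + H(σ,u)`, TORUS-UNIFORMLY** (`μ ≥ 0`; `H` local with letters
`(R, λ′, r, 1, n_B)` for a locator `loc`; torus rate `κ ≥ 0`, drop `2`, walk rate `κ + 3`): the one-walk expansion of the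
mass (§2) plus the one-step expansion of `H` (`B13LocalKernelWalks.jointWalkExpansion_local_c0`), added through the same `X`
by §1; constant `μ + K̄_loc(λ′, r, κ+3)` — NO DEPENDENCE ON `Nf`; the σ-carrying sub-family is `H`'s.
[cite: Balaban1985BackgroundPropagators, Thm 3.10 (3.107)–(3.108) p.416; Balaban1988RG2Cluster, (1.11) p.5, p.13, p.15] -/
theorem jointWalkExpansion_massLocal {ι : Type} [Fintype ι] [DecidableEq ι] (c : B13.Consts) (hκ₁ : 0 ≤ c.κ₁)
    {loc : ι → UT Nf} {H : LocalTerms d N' ν Nf ι ι E} {X : Finset (UT Nf)} {R lam' r : ℝ} {nB : ℕ}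
    (hH : H.IsLocal c loc loc X R lam' r 1 nB) (hlam' : 0 ≤ lam') {μ : ℝ} (hμ : 0 ≤ μ) {kap : ℝ} (hkap : 0 ≤ kap) :
    JointWalkExpansion c loc loc (massLocal (d := d) (N' := N') Nf μ H) X R 2 kap (μ + kbarLoc c lam' r (kap + 3) nB ν)
      (fun ω : Unit ⊕ H.B => Sum.elim (fun (_ : Unit) (_ : TPt d N' → ℂ) (_ : E) => (μ : ℂ) • (1 : Matrix ι ι ℂ)) H.term ω)
      {ω | Sum.elim (· ∈ (∅ : Set Unit)) (· ∈ H.sigmaCarrying) ω}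
      (fun ω => Sum.elim (fun _ => μ) (fun _ => lam' * Real.exp (c.κ₁ * (1 : ℕ)) * Real.exp ((kap + 3) * r)) ω)
      (fun ω => Sum.elim (fun _ => tdist1 Nf) H.dist ω) (kap + 3) := by
  have h₁ := jointWalkExpansion_mass (d := d) (N' := N') (E := E) c loc X (μ := μ) (R := R) (ε := 2) (kap := kap)
    (ρ := kap + 3) hμ (by linarith)
  have h₂ := LocalTerms.jointWalkExpansion_local_c0 hH hκ₁ hlam' (ρ := kap + 3) (ε := 2) (κ := kap) (μ := 1)
    (by linarith) hkap one_pos (by linarith)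
  have h := jointWalkExpansion_add h₁ h₂
  have hc0 := one_le_c0_pow (ν := ν) one_pos
  exact h.mono le_rfl le_rfl le_rfl (by positivity) (le_of_eq (by simp [kbarLoc]))

/-- **ACCRETIVITY OF A MODEL PRECISION at complex background** (print p. 15, the perturbative argument): on polydisc × ball,
`μ·1 + H(σ,u)` is `(μ − K̄_loc(λ′, r, 2)·c_V)`-accretive — row and column sums of `H(σ,u)` are `≤ K̄·c_V` by its OWN walk
majorants at torus rate `1` (`JointWalkExpansion.majorants`, walk rate `2`) and the rate-`1` volume sums of the locator.
[cite: Balaban1988RG2Cluster, p.15; Balaban1985BackgroundPropagators, (3.108) p.416] -/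
theorem accretive_massLocal {ι : Type} [Fintype ι] [DecidableEq ι] (c : B13.Consts) (hκ₁ : 0 ≤ c.κ₁)
    {loc : ι → UT Nf} {H : LocalTerms d N' ν Nf ι ι E} {X : Finset (UT Nf)} {R lam' r : ℝ} {nB : ℕ}
    (hH : H.IsLocal c loc loc X R lam' r 1 nB) (hlam' : 0 ≤ lam')
    (hvol : ∀ i : ι, ∑ j : ι, Real.exp (-(1 * tdist1 Nf (loc i) (loc j))) ≤ cV ν) (μ : ℝ) :
    ∀ σ : TPt d N' → ℂ, (∀ j, ‖σ j‖ ≤ Real.exp c.κ₁) → ∀ u ∈ ball (0 : E) R, ∀ v : ι → ℂ,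
      (μ - kbarLoc c lam' r 2 nB ν * cV ν) * ∑ i, ‖v i‖ ^ 2 ≤
        (∑ i, star (v i) * (massLocal (d := d) (N' := N') Nf μ H σ u *ᵥ v) i).re := by
  intro σ hσ u hu v
  -- `H`'s own expansion at torus rate 1 (drop 0, walk rate 2) gives its majorants
  have hD := LocalTerms.jointWalkExpansion_local_c0 hH hκ₁ hlam' (ρ := 2) (ε := 0) (κ := 1) (μ := 1) (by norm_num)
    zero_le_one one_pos (by norm_num)
  have hmaj := hD.majorants le_rfl σ hσ u hu
  have hc0 := one_le_c0_pow (ν := ν) one_pos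
  have hK : 0 ≤ lam' * Real.exp (c.κ₁ * (1 : ℕ)) * Real.exp (2 * r) * (nB * B6.c0 1 1 ^ ν) := by positivity
  have hrow := rowSum_le_of_majorants loc _ hK le_rfl hmaj hvol
  have hcol := colSum_le_of_majorants loc _ hK le_rfl hmaj hvol
  have hp : 0 ≤ kbarLoc c lam' r 2 nB ν * cV ν := mul_nonneg (kbarLoc_nonneg c hlam' r 2 nB ν) (one_le_cVat one_pos |>.trans' zero_le_one)
  exact accretive_mass_add μ hp _ hrow hcol v

/-- **The DIAGONAL model precision at the reference point is the complexification of the real diagonal `refDiag`.**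
[cite: Balaban1988RG2Cluster, p.15] -/
theorem massive_zero {ι : Type} [Fintype ι] [DecidableEq ι] (loc : ι → UT Nf) (μ lam : ℝ) (ℓ : E →L[ℂ] ℂ)
    (X : Finset (UT Nf)) (j₀ : TPt d N') :
    massLocal (d := d) (N' := N') Nf μ (diagTerms Nf loc lam ℓ X j₀) 0 0 = (refDiag Nf loc μ lam X).map (algebraMap ℝ ℂ) := by
  ext i j
  rw [show massLocal (d := d) (N' := N') Nf μ (diagTerms Nf loc lam ℓ X j₀) 0 0 =
      (μ : ℂ) • (1 : Matrix ι ι ℂ) + (diagTerms Nf loc lam ℓ X j₀).kernel 0 (0 : E) from rfl,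
    diagTerms_kernel_zero]
  by_cases h : i = j
  · subst h
    by_cases hX : loc i ∈ X <;> simp [refDiag, hX]
  · simp [refDiag, h, Matrix.one_apply_ne h]

omit [∀ i, NeZero (Nf i)] in
/-- **The reference value is positive definite** when `μ > 0` and `|λ| < μ` (all diagonal entries `> 0`).
[cite: Balaban1988RG2Cluster, p.15] -/
theorem refDiag_posDef {ι : Type} [Fintype ι] [DecidableEq ι] (loc : ι → UT Nf) {μ lam : ℝ} (hμ : 0 < μ)
    (hlam : |lam| < μ) (X : Finset (UT Nf)) : (refDiag Nf loc μ lam X).PosDef := by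
  refine Matrix.posDef_diagonal_iff.2 fun i => ?_
  by_cases hX : loc i ∈ X
  · simpa [hX] using hμ
  · rw [if_neg hX]
    linarith [neg_abs_le lam]

/-- A complex matrix with vanishing imaginary parts is the complexification of its real part. [folklore] -/
private theorem eq_map_re_of_im {p n : Type} {M : Matrix p n ℂ} (h : ∀ i j, (M i j).im = 0) :
    M = (M.map Complex.re).map (algebraMap ℝ ℂ) := by
  ext i j
  apply Complex.ext
  · simp
  · simp [h i j]

/-- The diagonal model precision is REAL at the reference point. [cite: Balaban1988RG2Cluster, p.15] -/
theorem im_massive_zero {ι : Type} [Fintype ι] [DecidableEq ι] (loc : ι → UT Nf) (μ lam : ℝ) (ℓ : E →L[ℂ] ℂ)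
    (X : Finset (UT Nf)) (j₀ : TPt d N') (i j : ι) :
    (massLocal (d := d) (N' := N') Nf μ (diagTerms Nf loc lam ℓ X j₀) 0 0 i j).im = 0 := by
  rw [massive_zero, Matrix.map_apply]
  simp

/-- The HOPPING model precision `μ·1 + H(σ,u)` is REAL at the reference point. [cite: Balaban1988RG2Cluster, p.15] -/
theorem im_massHop_zero {ι : Type} [Fintype ι] [DecidableEq ι] (er ec : UT Nf → ι) (μ t : ℝ) (ℓ : E →L[ℂ] ℂ)
    (X : Finset (UT Nf)) (j₀ : TPt d N') (i j : ι) :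
    (massLocal (d := d) (N' := N') Nf μ (hopTerms Nf er ec t ℓ X j₀) 0 0 i j).im = 0 := by
  rw [show massLocal (d := d) (N' := N') Nf μ (hopTerms Nf er ec t ℓ X j₀) 0 0 i j =
      ((μ : ℂ) • (1 : Matrix ι ι ℂ)) i j + (hopTerms Nf er ec t ℓ X j₀).kernel 0 (0 : E) i j from rfl,
    Complex.add_im, im_hop_kernel_zero]
  by_cases h : i = j
  · subst h; simp
  · simp [Matrix.one_apply_ne h]

/-- **`invSqrt` OF THE COMPLEXIFICATION OF ANY REAL MATRIX IS REAL** (no symmetry needed): the resolvents are real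
(`B13Sqrt27Accretive.resolvent_map_ofReal`) and so is their `x^{−1/2}`-weighted integral (`integral_ofReal`).
[cite: Balaban1988RG2Cluster, (2.7) p.13, p.15] -/
theorem im_invSqrt_map_ofReal {ι : Type} [Fintype ι] [DecidableEq ι] (T : Matrix ι ι ℝ) (i j : ι) :
    (invSqrt (T.map (algebraMap ℝ ℂ)) i j).im = 0 := by
  rw [B13Sqrt27Accretive.invSqrt_apply]
  have hint : ∀ x : ℝ, (Real.sqrt x)⁻¹ • ((x : ℂ) • (1 : Matrix ι ι ℂ) + T.map (algebraMap ℝ ℂ))⁻¹ i j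
      = (((Real.sqrt x)⁻¹ * (x • (1 : Matrix ι ι ℝ) + T)⁻¹ i j : ℝ) : ℂ) := by
    intro x
    rw [B13Sqrt27Accretive.resolvent_map_ofReal, Matrix.map_apply, Complex.coe_algebraMap, Complex.ofReal_mul,
      Complex.real_smul]
  have h2 : (∫ x in Ioi (0 : ℝ), (((Real.sqrt x)⁻¹ * (x • (1 : Matrix ι ι ℝ) + T)⁻¹ i j : ℝ) : ℂ))
      = ((∫ x in Ioi (0 : ℝ), (Real.sqrt x)⁻¹ * (x • (1 : Matrix ι ι ℝ) + T)⁻¹ i j : ℝ) : ℂ) :=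
    integral_ofReal
  rw [MeasureTheory.setIntegral_congr_fun measurableSet_Ioi (fun x _ => hint x), h2, Complex.real_smul,
    ← Complex.ofReal_mul, Complex.ofReal_im]

/-- **The σ-carrying sub-family of a diagonal model family contains every index located in the σ-region.**
[cite: Balaban1988RG2Cluster, p.13] -/
theorem sigmaCarrying_diag_nonempty {ι : Type} [Fintype ι] [DecidableEq ι] (loc : ι → UT Nf) (lam : ℝ)
    (ℓ : E →L[ℂ] ℂ) {X : Finset (UT Nf)} (j₀ : TPt d N') {b : ι} (hb : loc b ∈ X) :
    b ∈ (diagTerms (d := d) (N' := N') Nf loc lam ℓ X j₀).sigmaCarrying := by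
  show ((diagTerms (d := d) (N' := N') (E := E) Nf loc lam ℓ X j₀).J b).Nonempty
  simp [hb]

/-- The σ-carrying sub-family of a hopping family contains every term starting in `X`. [cite: Balaban1988RG2Cluster, p.13] -/
theorem sigmaCarrying_hop_nonempty {p n : Type} [DecidableEq p] [DecidableEq n] (er : UT Nf → p) (ec : UT Nf → n)
    (t : ℝ) (ℓ : E →L[ℂ] ℂ) {X : Finset (UT Nf)} (j₀ : TPt d N') {b : UT Nf × Fin ν} (hb : b.1 ∈ X) :
    b ∈ (hopTerms (d := d) (N' := N') Nf er ec t ℓ X j₀).sigmaCarrying := by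
  show ((hopTerms (d := d) (N' := N') (E := E) Nf er ec t ℓ X j₀).J b).Nonempty
  simp [hb]

end Precisions

/-! ## §6. The model `TermKernels` record (real reference data, `C` positive definite, the (2.7) reading by `rfl`) -/

section Kernels

/-- **The Γ-kernel `G2 = L·P^{−1/2}` is REAL at the reference point** for the hopping local factor `L` and ANY full
precision `P` real at the reference point (§5: `L(0,0)` real, `invSqrt` of a real matrix real). [cite: Balaban1988RG2Cluster, (2.7) p.13, p.15] -/
theorem im_gamma_zero (t : ℝ) (ℓ : E →L[ℂ] ℂ) (X : Finset (UT Nf)) (j₀ : TPt d N')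
    {P : (TPt d N' → ℂ) → E → Matrix (UT Nf ⊕ UT Nf) (UT Nf ⊕ UT Nf) ℂ} (hP : ∀ k l, (P 0 0 k l).im = 0) (i : UT Nf)
    (j : UT Nf ⊕ UT Nf) :
    (((hopTerms (d := d) (N' := N') Nf id (Sum.inr : UT Nf → UT Nf ⊕ UT Nf) t ℓ X j₀).kernel 0 0 * invSqrt (P 0 0)) i j).im
      = 0 := by
  rw [eq_map_re_of_im hP, Matrix.mul_apply, Complex.im_sum]
  refine Finset.sum_eq_zero fun k _ => ?_
  rw [Complex.mul_im, im_hop_kernel_zero, im_invSqrt_map_ofReal]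
  simp

variable (Nf)

/-- MODEL. **THE MODEL `TermKernels` RECORD** on the site torus `UT Nf`: rows `Λ` = the sites (`locΛ = id`, fibre bound `1`),
extra columns `C₀` = a second copy of the sites (`locN = Sum.elim id id`), σ-region `X`; term precision `A2 = μ_A·1 + D_A`
(diagonal family, coupling `λ_A`; `μ_A > 0`, `|λ_A| < μ_A`), Γ-kernel `G2 = L·P^{−1/2}` — the (2.7) reading — with `L` the
forward hopping into the second copy (coupling `t`) and `P` ANY full precision on `Λ ⊕ C₀` real at the reference point (`hP`; print's
`(U,0)`-precision is moreover SYMMETRIC, p. 15 — not imposed here); `Γ₀ = Re G2(0,0)`, `C = refDiag_A⁻¹`; `hG0`, `hC0`, `hC` PROVED.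
[cite: Balaban1988RG2Cluster, (2.7) p.13, (2.14)–(2.15) p.15] -/
abbrev modelKernels (c : B13.Consts) (X : Finset (UT Nf)) (j₀ : TPt d N') (ℓ : E →L[ℂ] ℂ) (t : ℝ)
    (P : (TPt d N' → ℂ) → E → Matrix (UT Nf ⊕ UT Nf) (UT Nf ⊕ UT Nf) ℂ) (hP : ∀ k l, (P 0 0 k l).im = 0)
    {μA lamA : ℝ} (hμA : 0 < μA) (hlamA : |lamA| < μA) : B13TermWalkData.TermKernels c d N' ν Nf E where
  Λ := UT Nf
  C₀ := UT Nf
  A2 := massLocal Nf μA (diagTerms Nf id lamA ℓ X j₀)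
  G2 := fun σ u => (hopTerms Nf id Sum.inr t ℓ X j₀).kernel σ u * invSqrt (P σ u)
  Γ₀ := ((hopTerms Nf id Sum.inr t ℓ X j₀).kernel 0 0 * invSqrt (P 0 0)).map Complex.re
  C := (refDiag Nf id μA lamA X)⁻¹
  locΛ := id
  locN := Sum.elim id id
  X := X
  m := 1
  hfib := fun x => by
    rw [show (Finset.univ.filter fun i : UT Nf => id i = x) = {x} by ext i; simp]
    simp
  hG0 := eq_map_re_of_im fun i j => im_gamma_zero t ℓ X j₀ hP i j
  hC0 := by
    have hpos := refDiag_posDef (Nf := Nf) id hμA hlamA X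
    have hdet : IsUnit (refDiag Nf id μA lamA X).det := (Matrix.isUnit_iff_isUnit_det _).1 hpos.isUnit
    show (massLocal Nf μA (diagTerms Nf id lamA ℓ X j₀) 0 (0 : E))⁻¹ = ((refDiag Nf id μA lamA X)⁻¹).map (algebraMap ℝ ℂ)
    rw [massive_zero]
    apply Matrix.inv_eq_right_inv
    rw [← Matrix.map_mul, Matrix.mul_nonsing_inv _ hdet, Matrix.map_one _ (map_zero _) (map_one _)]
  hC := (refDiag_posDef (Nf := Nf) id hμA hlamA X).inv

variable {Nf}

omit [∀ i, NeZero (Nf i)] in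
/-- The locator `Sum.elim id id` of the two copies has fibres of size `≤ 2`. [folklore] -/
private theorem hfib_two (z : UT Nf) :
    (Finset.univ.filter fun b : UT Nf ⊕ UT Nf => Sum.elim id id b = z).card ≤ 2 := by
  classical
  calc (Finset.univ.filter fun b : UT Nf ⊕ UT Nf => Sum.elim id id b = z).card
      ≤ ({Sum.inl z, Sum.inr z} : Finset (UT Nf ⊕ UT Nf)).card := by
        refine Finset.card_le_card fun b hb => ?_
        simp only [Finset.mem_filter, Finset.mem_univ, true_and] at hb
        rcases b with b | b
        · simp only [Sum.elim_inl, id] at hb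
          simp [hb]
        · simp only [Sum.elim_inr, id] at hb
          simp [hb]
    _ ≤ 2 := Finset.card_le_two

omit [∀ i, NeZero (Nf i)] in
/-- The identity locator has fibres of size `≤ 1`. [folklore] -/
private theorem hfib_id (z : UT Nf) : (Finset.univ.filter fun b : UT Nf => id b = z).card ≤ 1 := by
  rw [show (Finset.univ.filter fun b : UT Nf => id b = z) = {z} by ext i; simp]
  simp

end Kernels

/-! ## §7. The effective constants of the witnesses (all functions of `(ν, κ₁, couplings, masses, ‖ℓ‖R)`, never of `Nf`) -/

section Constants

/-- The EFFECTIVE COUPLING `λ′ = |λ|(1 + ‖ℓ‖R)` of an affine coefficient `λ(1 + ℓ(u))` on the `R`-ball. [cite: Balaban1988RG2Cluster, p.15] -/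
def lamEff (lam : ℝ) (ℓ : E →L[ℂ] ℂ) (R : ℝ) : ℝ := |lam| * (1 + ‖ℓ‖ * R)

/-- `λ′ ≥ 0` for `R ≥ 0`. [folklore] -/
private theorem lamEff_nonneg (lam : ℝ) (ℓ : E →L[ℂ] ℂ) {R : ℝ} (hR : 0 ≤ R) : 0 ≤ lamEff lam ℓ R := by
  unfold lamEff
  have : 0 ≤ ‖ℓ‖ * R := mul_nonneg (norm_nonneg _) hR
  positivity

/-- The MAJORANT CONSTANT `K̄ = μ + K̄_loc(λ′, r, ρ_w)` of a model precision (`n_B` = fibre bound ∕ terms per site).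
[cite: Balaban1985BackgroundPropagators, (3.108) p.416] -/
def kbarPrec (c : B13.Consts) (μ lam : ℝ) (ℓ : E →L[ℂ] ℂ) (R r ρw : ℝ) (nB ν : ℕ) : ℝ :=
  μ + kbarLoc c (lamEff lam ℓ R) r ρw nB ν

/-- The ACCRETIVITY CONSTANT `m = μ − K̄_loc(λ′, r, 2)·c_V` of a model precision (print's perturbative argument, p. 15).
[cite: Balaban1988RG2Cluster, p.15] -/
def mAcc (c : B13.Consts) (μ lam : ℝ) (ℓ : E →L[ℂ] ℂ) (R r : ℝ) (nB ν : ℕ) : ℝ :=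
  μ - kbarLoc c (lamEff lam ℓ R) r 2 nB ν * cV ν

/-- The Combes–Thomas rate `κ_C = min(½, m_A∕(4K̄_Ac))` of the model covariance against a volume constant `c`
(`8K̄_Aκ_Cc ≤ 2m_A`, `κ_C ≤ ρ_E∕4` with `ρ_E = 2`). [cite: Balaban1988RG2Cluster, (2.16) p.16] -/
def kapCov (c : B13.Consts) (μA lamA : ℝ) (ℓ : E →L[ℂ] ℂ) (R cc : ℝ) (ν : ℕ) : ℝ :=
  min (1 / 2) (mAcc c μA lamA ℓ R 0 1 ν / (4 * kbarPrec c μA lamA ℓ R 0 0 1 ν * cc))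

/-- A positive accretivity constant forces `|λ| < μ` (`λ′ ≤ K̄_loc·c_V`, `|λ| ≤ λ′`). [cite: Balaban1988RG2Cluster, p.15] -/
theorem abs_lt_of_mAcc_pos (c : B13.Consts) (hκ₁ : 0 ≤ c.κ₁) {μ lam : ℝ} (ℓ : E →L[ℂ] ℂ) {R r : ℝ} (hR : 0 ≤ R) (hr : 0 ≤ r)
    {nB : ℕ} (hnB : 1 ≤ nB) (h : 0 < mAcc c μ lam ℓ R r nB ν) : |lam| < μ := by
  have h1 := le_kbarLoc_mul_cV c hκ₁ (lamEff_nonneg lam ℓ hR) (by positivity : (0 : ℝ) ≤ 2 * r) hnB ν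
  have h2 : |lam| ≤ lamEff lam ℓ R := by
    unfold lamEff
    have : 0 ≤ ‖ℓ‖ * R := mul_nonneg (norm_nonneg _) hR
    nlinarith [abs_nonneg lam]
  unfold mAcc at h
  linarith

end Constants

/-! ## §8. WITNESS 1 — `termLetters_of_walks` AS TYPED (single volume constant), DIAGONAL full precision -/

section WitnessOne

/-- The torus rate `κ_P = 12 + 24K̄_Pc_V∕m_P` at which the DIAGONAL full precision is expanded — admissible because a range-`0`
family decays at EVERY rate with the same constant; this is exactly what the single-constant bookkeeping of §4
(`8K̄_Pκc_V ≤ m_Pκ_P` with `κ ≥ 3`) demands and what a precision with off-diagonal entries cannot offer (memo cell ym-nodeO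
P3 g24; see `termLetters_model₂` for the two-constant edition). [cite: Balaban1988RG2Cluster, (2.16) p.16] -/
def kapPrec (c : B13.Consts) (μP lamP : ℝ) (ℓ : E →L[ℂ] ℂ) (R : ℝ) (ν : ℕ) : ℝ :=
  12 + 24 * kbarPrec c μP lamP ℓ R 0 0 2 ν * cV ν / mAcc c μP lamP ℓ R 0 2 ν

/-- **WITNESS 1: `termLetters_of_walks` AS TYPED is inhabited, torus-uniformly, with non-empty σ-carrying families** — at the
price of a RANGE-0 full precision.  On every site torus, for every non-empty `X`, `j₀`, `ℓ`, `R > 0`, hopping coupling `t`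
of the local factor and precision data with POSITIVE accretivity constants `m_P`, `m_A` (a torus-independent smallness of
`λ_P`, `λ_A`): `TermLetters` of the model term with `P = μ_P·1 + D_P` DIAGONAL at rate `ρ′ = 1`, covariance rate `κ_C > 0`,
rates `(κ, θ′, ρ_L, ρ_E, ρ₀, ρ′, η) = (3, 2, 2, 2, 2, 1, 1)`, `κ_P = 12 + 24K̄_Pc_V∕m_P`, every constant a function of
`(ν, κ₁, t, λ_P, λ_A, μ_P, μ_A, ‖ℓ‖R)`.  NOTHING about Bałaban's kernels. [cite: Balaban1988RG2Cluster, (2.7) p.13, p.15, (2.14)–(2.16) pp.15–16; Balaban1985BackgroundPropagators, Thm 3.10 p.416; Balaban1984PropagatorsII, (2.61) p.234] -/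
theorem termLetters_model (c : B13.Consts) (hκ₁ : 0 ≤ c.κ₁) {X : Finset (UT Nf)} (hX : X.Nonempty) (j₀ : TPt d N')
    (ℓ : E →L[ℂ] ℂ) {R : ℝ} (hR : 0 < R) (t : ℝ) {μP lamP μA lamA : ℝ} (hμP : 0 < μP) (hμA : 0 < μA)
    (hmP : 0 < mAcc c μP lamP ℓ R 0 2 ν) (hmA : 0 < mAcc c μA lamA ℓ R 0 1 ν) :
    TermLetters (modelKernels (d := d) (N' := N') Nf c X j₀ ℓ t
        (massLocal Nf μP (diagTerms Nf (Sum.elim id id) lamP ℓ X j₀)) (im_massive_zero (Sum.elim id id) μP lamP ℓ X j₀)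
        hμA (abs_lt_of_mAcc_pos c hκ₁ ℓ hR.le le_rfl le_rfl hmA))
      R 1 (kapCov c μA lamA ℓ R (cV ν) ν)
      (kbarLoc c (lamEff t ℓ R) 1 5 ν ν * (4 / Real.sqrt (mAcc c μP lamP ℓ R 0 2 ν)) * cV ν)
      ((2 * kbarLoc c (lamEff t ℓ R) 1 5 ν ν * (4 / Real.sqrt (mAcc c μP lamP ℓ R 0 2 ν)) +
        kbarLoc c (lamEff t ℓ R) 1 5 ν ν * (16 * (2 * kbarPrec c μP lamP ℓ R 0 0 2 ν) * cV ν ^ 2 /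
          (mAcc c μP lamP ℓ R 0 2 ν * Real.sqrt (mAcc c μP lamP ℓ R 0 2 ν)))) * cV ν)
      (kbarPrec c μA lamA ℓ R 0 0 1 ν) (2 * kbarPrec c μA lamA ℓ R 0 0 1 ν) (4 / mAcc c μA lamA ℓ R 0 1 ν) 0 := by
  have hR0 : 0 ≤ R := hR.le
  have hℓR : 0 ≤ ‖ℓ‖ * R := mul_nonneg (norm_nonneg _) hR0
  have hc0 := one_le_c0_pow (ν := ν) one_pos
  have hcV : 0 < cV ν := zero_lt_one.trans_le (one_le_cVat one_pos)
  have htP := lamEff_nonneg lamP ℓ hR0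
  have htA := lamEff_nonneg lamA ℓ hR0
  -- positivity of the constants
  have hKDP : 0 ≤ kbarLoc c (lamEff lamP ℓ R) 0 0 2 ν := kbarLoc_nonneg c htP 0 0 2 ν
  have hKDA : 0 ≤ kbarLoc c (lamEff lamA ℓ R) 0 0 1 ν := kbarLoc_nonneg c htA 0 0 1 ν
  have hKP : 0 < kbarPrec c μP lamP ℓ R 0 0 2 ν := by unfold kbarPrec; linarith
  have hKA : 0 < kbarPrec c μA lamA ℓ R 0 0 1 ν := by unfold kbarPrec; linarith
  have hκC : 0 < kapCov c μA lamA ℓ R (cV ν) ν := lt_min (by norm_num) (by positivity)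
  -- the torus rate of the full precision
  have hkapP12 : 12 ≤ kapPrec c μP lamP ℓ R ν := by
    unfold kapPrec
    have : 0 ≤ 24 * kbarPrec c μP lamP ℓ R 0 0 2 ν * cV ν / mAcc c μP lamP ℓ R 0 2 ν := by positivity
    linarith
  have hkapPm : 8 * kbarPrec c μP lamP ℓ R 0 0 2 ν * 3 * cV ν ≤ mAcc c μP lamP ℓ R 0 2 ν * kapPrec c μP lamP ℓ R ν := by
    unfold kapPrec
    rw [mul_add, mul_div_assoc', mul_div_cancel_left₀ _ hmP.ne']
    nlinarith [hmP, hKP.le, hcV.le]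
  -- the three joint walk expansions (the diagonal precision's constant is the same at every walk rate: `e^{ρ·0} = 1`)
  have hJL₀ := LocalTerms.jointWalkExpansion_local_c0
    (hopTerms_isLocal (d := d) (N' := N') c (er := id) (ec := Sum.inr) (locp := id) (locn := Sum.elim id id)
      (fun _ => rfl) (fun _ => rfl) t ℓ X j₀ R) hκ₁
    (by positivity) (ρ := 5) (ε := 2) (κ := 2) (μ := 1) (by norm_num) (by norm_num) one_pos (by norm_num)
  have hJL : JointWalkExpansion c id (Sum.elim id id) (hopTerms (d := d) (N' := N') Nf id Sum.inr t ℓ X j₀).kernel X R 2 2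
      (kbarLoc c (lamEff t ℓ R) 1 5 ν ν) _ _ _ _ 5 :=
    hJL₀.mono le_rfl le_rfl le_rfl (by positivity) (le_of_eq (by simp [kbarLoc, lamEff]))
  have hJP₀ := jointWalkExpansion_massLocal (d := d) (N' := N') c hκ₁
    (diagTerms_isLocal c (Sum.elim id id) hfib_two lamP ℓ X j₀ R) htP hμP.le (kap := kapPrec c μP lamP ℓ R ν) (by linarith)
  have hJP : JointWalkExpansion c (Sum.elim id id) (Sum.elim id id)
      (massLocal (d := d) (N' := N') Nf μP (diagTerms Nf (Sum.elim id id) lamP ℓ X j₀)) X R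
      2 (kapPrec c μP lamP ℓ R ν) (kbarPrec c μP lamP ℓ R 0 0 2 ν) _ _ _ _ (kapPrec c μP lamP ℓ R ν + 3) :=
    hJP₀.mono le_rfl le_rfl le_rfl (add_nonneg hμP.le (kbarLoc_nonneg c htP _ _ _ _))
      (le_of_eq (by simp [kbarPrec, kbarLoc, lamEff]))
  have hJA₀ := jointWalkExpansion_massLocal (d := d) (N' := N') c hκ₁ (diagTerms_isLocal c id hfib_id lamA ℓ X j₀ R) htA
    hμA.le (kap := 2) (by norm_num)
  have hJA : JointWalkExpansion c id id (massLocal (d := d) (N' := N') Nf μA (diagTerms Nf id lamA ℓ X j₀)) X R 2 2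
      (kbarPrec c μA lamA ℓ R 0 0 1 ν) _ _ _ _ (2 + 3) :=
    hJA₀.mono le_rfl le_rfl le_rfl (add_nonneg hμA.le (kbarLoc_nonneg c htA _ _ _ _))
      (le_of_eq (by simp [kbarPrec, kbarLoc, lamEff]))
  -- the two accretivity constants
  have hPacc := accretive_massLocal (d := d) (N' := N') c hκ₁ (diagTerms_isLocal c (Sum.elim id id) hfib_two lamP ℓ X j₀ R)
    htP (fun i => (volume_two_cVat (Nf := Nf) one_pos _).1) μP
  have hAacc := accretive_massLocal (d := d) (N' := N') c hκ₁ (diagTerms_isLocal c id hfib_id lamA ℓ X j₀ R) htA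
    (fun i => volume_id_cVat (Nf := Nf) one_pos _) μA
  -- the Combes–Thomas smallness of the covariance: 8K̄_Aκ_Cc_V ≤ 8K̄_A·(m_A∕(4K̄_Ac_V))·c_V = 2m_A
  have hκCm : 8 * kbarPrec c μA lamA ℓ R 0 0 1 ν * kapCov c μA lamA ℓ R (cV ν) ν * cV ν ≤
      mAcc c μA lamA ℓ R 0 1 ν * 2 := by
    calc 8 * kbarPrec c μA lamA ℓ R 0 0 1 ν * kapCov c μA lamA ℓ R (cV ν) ν * cV ν
        ≤ 8 * kbarPrec c μA lamA ℓ R 0 0 1 ν *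
            (mAcc c μA lamA ℓ R 0 1 ν / (4 * kbarPrec c μA lamA ℓ R 0 0 1 ν * cV ν)) * cV ν := by
          gcongr
          exact min_le_right _ _
      _ = mAcc c μA lamA ℓ R 0 1 ν * 2 := by
          field_simp
          ring
  exact termLetters_of_walks
    (modelKernels (d := d) (N' := N') Nf c X j₀ ℓ t
      (massLocal Nf μP (diagTerms Nf (Sum.elim id id) lamP ℓ X j₀)) (im_massive_zero (Sum.elim id id) μP lamP ℓ X j₀)
      hμA (abs_lt_of_mAcc_pos c hκ₁ ℓ hR.le le_rfl le_rfl hmA))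
    hX (hopTerms (d := d) (N' := N') Nf id Sum.inr t ℓ X j₀).kernel
    (massLocal (d := d) (N' := N') Nf μP (diagTerms Nf (Sum.elim id id) lamP ℓ X j₀)) (fun σ u => rfl) hR
    hJL (by norm_num) (by norm_num)
    hJP (by norm_num) (by linarith) hmP hPacc
    hJA (by norm_num) (by norm_num) hmA hAacc
    (η := 1) (cV := cV ν) (Rσ := 0) zero_le_one hcV.le
    (fun i => (volume_two_cVat (Nf := Nf) one_pos _).1) (fun j => (volume_two_cVat (Nf := Nf) one_pos _).2)
    (fun i => (volume_two_cVat (Nf := Nf) one_pos _).1) (fun i => volume_id_cVat (Nf := Nf) one_pos _)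
    (fun b z _ => tdist1_nonneg _ _)
    (κ := 3) (θ' := 2) (ρL := 2) (ρE := 2) (κC := kapCov c μA lamA ℓ R (cV ν) ν) (ρ₀ := 2) (ρ' := 1)
    (by norm_num) (by linarith) hkapPm (by linarith)
    (by norm_num) (by norm_num) (by norm_num)
    (by norm_num) (by norm_num)
    (by norm_num) (by norm_num) (by norm_num) (by norm_num)
    hκC.le (min_le_left _ _ |>.trans (by norm_num)) hκCm
    (by norm_num) (by norm_num) (by norm_num) (by norm_num) (by norm_num)

end WitnessOne

/-! ## §9. WITNESS 2 — the two-constant `termLetters_of_walks₂` with a HOPPING full precision at torus rate `κ_P = 1` -/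

section WitnessTwo

/-- The accretivity constant in closed form: `m = μ − |λ|·Q` with `Q = (1 + ‖ℓ‖R)e^{κ₁}e^{2r}·n_Bc₀(1,1)^ν·c_V ≥ 0` — positive
for every coupling `|λ| < μ∕Q`, in particular for NON-ZERO couplings (the witnesses are not the λ = 0 degenerate case).
[cite: Balaban1988RG2Cluster, p.15] -/
theorem mAcc_eq (c : B13.Consts) (μ lam : ℝ) (ℓ : E →L[ℂ] ℂ) (R r : ℝ) (nB ν : ℕ) :
    mAcc c μ lam ℓ R r nB ν =
      μ - |lam| * ((1 + ‖ℓ‖ * R) * Real.exp (c.κ₁ * (1 : ℕ)) * Real.exp (2 * r) * (nB * B6.c0 1 1 ^ ν) * cV ν) := by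
  unfold mAcc kbarLoc lamEff; ring

/-- The Combes–Thomas rate `κ = m_P∕(8K̄_Pc_V₀)` of the HOPPING full precision at torus rate `κ_P = 1` (walk rate `4`), with
the rate-`½` volume constant `c_V₀ = c_V(½)`: `8K̄_Pκc_V₀ = m_P·κ_P` on the nose, `κ ≤ ⅛ ≤ κ_P∕4`. [cite: Balaban1988RG2Cluster, (2.16) p.16] -/
def kapCT (c : B13.Consts) (μP tP : ℝ) (ℓ : E →L[ℂ] ℂ) (R : ℝ) (ν : ℕ) : ℝ :=
  mAcc c μP tP ℓ R 1 ν ν / (8 * kbarPrec c μP tP ℓ R 1 4 ν ν * cVat (1 / 2) ν)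

/-- **WITNESS 2: THE TWO-CONSTANT `termLetters_of_walks₂` IS INHABITED BY A FINITE-DIFFERENCE-TYPE PRECISION, torus-uniformly,
with non-empty σ-carrying families.**  Full precision `P = μ_P·1 + H_P(σ,u)` with `H_P` forward nearest-neighbour HOPPING
from the first into the second copy of the sites (coupling `t_P(1 + ℓ(u))`, `σ_{j₀}` on the bonds starting in `X`) —
off-diagonal entries comparable to the couplings, torus rate `κ_P = 1` (no large rate: the Combes–Thomas condition runs on its
own volume constant `c_V₀ = c_V(½)`); term precision `A2 = μ_A·1 + D_A` diagonal, local factor `L` hopping (coupling `t`).  (One-directional `H_P`: `H_P² = L·H_P = 0`, `G2 = μ_P^{−1/2}L` — READ-331; symmetric edition `…WitnessSym.termLetters_model₃`.)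
Hypotheses: `κ₁ ≥ 0`, `X ≠ ∅`, `R > 0`, `μ_P, μ_A > 0` and the torus-INDEPENDENT smallness `m_P > 0`, `m_A > 0` (`mAcc_eq`).
Rates: `κ = m_P∕(8K̄_Pc_V₀)`, `(θ′, ρ_L, ρ₀) = ⅔κ`, `(η, ρ′) = ⅓κ`, `ρ_E = 2`, `c_V = c_V(κ∕3)`, `κ_C = min(½, m_A∕(4K̄_Ac_V))`.
Conclusion: `TermLetters` of the model term at rate `ρ′ = κ∕3 > 0`, covariance rate `κ_C > 0`, every constant a function of
`(ν, κ₁, t, t_P, λ_A, μ_P, μ_A, ‖ℓ‖R)` only.  NOTHING about Bałaban's kernels. [cite: Balaban1988RG2Cluster, (2.7) p.13, p.15, (2.14)–(2.16) pp.15–16; Balaban1985BackgroundPropagators, Thm 3.10 p.416, (3.154) p.427; Balaban1984PropagatorsII, (2.61) p.234] -/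
theorem termLetters_model₂ (c : B13.Consts) (hκ₁ : 0 ≤ c.κ₁) {X : Finset (UT Nf)} (hX : X.Nonempty) (j₀ : TPt d N')
    (ℓ : E →L[ℂ] ℂ) {R : ℝ} (hR : 0 < R) (t : ℝ) {μP tP μA lamA : ℝ} (hμP : 0 < μP) (hμA : 0 < μA)
    (hmP : 0 < mAcc c μP tP ℓ R 1 ν ν) (hmA : 0 < mAcc c μA lamA ℓ R 0 1 ν) :
    TermLetters (modelKernels (d := d) (N' := N') Nf c X j₀ ℓ t
        (massLocal Nf μP (hopTerms Nf Sum.inl Sum.inr tP ℓ X j₀)) (im_massHop_zero Sum.inl Sum.inr μP tP ℓ X j₀)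
        hμA (abs_lt_of_mAcc_pos c hκ₁ ℓ hR.le le_rfl le_rfl hmA))
      R (kapCT c μP tP ℓ R ν / 3) (kapCov c μA lamA ℓ R (cVat (kapCT c μP tP ℓ R ν / 3) ν) ν)
      (kbarLoc c (lamEff t ℓ R) 1 5 ν ν * (4 / Real.sqrt (mAcc c μP tP ℓ R 1 ν ν)) * cVat (kapCT c μP tP ℓ R ν / 3) ν)
      ((2 * kbarLoc c (lamEff t ℓ R) 1 5 ν ν * (4 / Real.sqrt (mAcc c μP tP ℓ R 1 ν ν)) +
        kbarLoc c (lamEff t ℓ R) 1 5 ν ν * (16 * (2 * kbarPrec c μP tP ℓ R 1 4 ν ν) *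
          cVat (kapCT c μP tP ℓ R ν / 3) ν ^ 2 / (mAcc c μP tP ℓ R 1 ν ν * Real.sqrt (mAcc c μP tP ℓ R 1 ν ν)))) *
        cVat (kapCT c μP tP ℓ R ν / 3) ν)
      (kbarPrec c μA lamA ℓ R 0 0 1 ν) (2 * kbarPrec c μA lamA ℓ R 0 0 1 ν) (4 / mAcc c μA lamA ℓ R 0 1 ν) 0 := by
  have hR0 : 0 ≤ R := hR.le
  have hℓR : 0 ≤ ‖ℓ‖ * R := mul_nonneg (norm_nonneg _) hR0
  have hc0 := one_le_c0_pow (ν := ν) one_pos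
  have htP := lamEff_nonneg tP ℓ hR0
  have htA := lamEff_nonneg lamA ℓ hR0
  -- the constants
  set κ := kapCT c μP tP ℓ R ν with hκdef
  have hcV₀ : 1 ≤ cVat (1 / 2) ν := one_le_cVat (by norm_num)
  have hKHP : 0 ≤ kbarLoc c (lamEff tP ℓ R) 1 4 ν ν := kbarLoc_nonneg c htP 1 4 ν ν
  have hKDA : 0 ≤ kbarLoc c (lamEff lamA ℓ R) 0 0 1 ν := kbarLoc_nonneg c htA 0 0 1 ν
  have hKP : 0 < kbarPrec c μP tP ℓ R 1 4 ν ν := by unfold kbarPrec; linarith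
  have hKA : 0 < kbarPrec c μA lamA ℓ R 0 0 1 ν := by unfold kbarPrec; linarith
  have hmK : mAcc c μP tP ℓ R 1 ν ν ≤ kbarPrec c μP tP ℓ R 1 4 ν ν := by
    have h1 : 0 ≤ kbarLoc c (lamEff tP ℓ R) 1 2 ν ν * cV ν :=
      mul_nonneg (kbarLoc_nonneg c htP 1 2 ν ν) (zero_le_one.trans (one_le_cVat one_pos))
    unfold mAcc kbarPrec; linarith
  have hκpos : 0 < κ := by rw [hκdef]; unfold kapCT; positivity
  have hκ8 : κ ≤ 1 / 8 := by
    rw [hκdef]; unfold kapCT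
    rw [div_le_iff₀ (by positivity)]
    nlinarith [hmK, hKP.le, hcV₀, hmP.le]
  have hκm : 8 * kbarPrec c μP tP ℓ R 1 4 ν ν * κ * cVat (1 / 2) ν = mAcc c μP tP ℓ R 1 ν ν * 1 := by
    rw [hκdef]; unfold kapCT
    field_simp
  have hη : 0 < κ / 3 := by positivity
  have hcVη : 0 < cVat (κ / 3) ν := zero_lt_one.trans_le (one_le_cVat hη)
  have hκC : 0 < kapCov c μA lamA ℓ R (cVat (κ / 3) ν) ν := lt_min (by norm_num) (by positivity)
  -- the three joint walk expansions
  have hJL₀ := LocalTerms.jointWalkExpansion_local_c0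
    (hopTerms_isLocal (d := d) (N' := N') c (er := id) (ec := Sum.inr) (locp := id) (locn := Sum.elim id id)
      (fun _ => rfl) (fun _ => rfl) t ℓ X j₀ R) hκ₁
    (by positivity) (ρ := 5) (ε := 2) (κ := 2) (μ := 1) (by norm_num) (by norm_num) one_pos (by norm_num)
  have hJL : JointWalkExpansion c id (Sum.elim id id) (hopTerms (d := d) (N' := N') Nf id Sum.inr t ℓ X j₀).kernel X R 2 2
      (kbarLoc c (lamEff t ℓ R) 1 5 ν ν) _ _ _ _ 5 :=
    hJL₀.mono le_rfl le_rfl le_rfl (by positivity) (le_of_eq (by simp [kbarLoc, lamEff]))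
  have hHP := hopTerms_isLocal (d := d) (N' := N') c (er := Sum.inl) (ec := Sum.inr) (locp := Sum.elim id id)
    (locn := Sum.elim id id) (fun _ => rfl) (fun _ => rfl) tP ℓ X j₀ R
  have hJP₀ := jointWalkExpansion_massLocal (d := d) (N' := N') c hκ₁ hHP htP hμP.le (kap := 1) zero_le_one
  have hJP : JointWalkExpansion c (Sum.elim id id) (Sum.elim id id)
      (massLocal (d := d) (N' := N') Nf μP (hopTerms Nf Sum.inl Sum.inr tP ℓ X j₀)) X R 2 1
      (kbarPrec c μP tP ℓ R 1 4 ν ν) _ _ _ _ (1 + 3) :=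
    hJP₀.mono le_rfl le_rfl le_rfl (add_nonneg hμP.le (kbarLoc_nonneg c htP _ _ _ _))
      (le_of_eq (by simp only [kbarPrec, kbarLoc, lamEff]; norm_num))
  have hJA₀ := jointWalkExpansion_massLocal (d := d) (N' := N') c hκ₁ (diagTerms_isLocal c id hfib_id lamA ℓ X j₀ R) htA
    hμA.le (kap := 2) (by norm_num)
  have hJA : JointWalkExpansion c id id (massLocal (d := d) (N' := N') Nf μA (diagTerms Nf id lamA ℓ X j₀)) X R 2 2
      (kbarPrec c μA lamA ℓ R 0 0 1 ν) _ _ _ _ (2 + 3) :=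
    hJA₀.mono le_rfl le_rfl le_rfl (add_nonneg hμA.le (kbarLoc_nonneg c htA _ _ _ _))
      (le_of_eq (by simp [kbarPrec, kbarLoc, lamEff]))
  -- the two accretivity constants
  have hPacc := accretive_massLocal (d := d) (N' := N') c hκ₁ hHP htP
    (fun i => (volume_two_cVat (Nf := Nf) one_pos _).1) μP
  have hAacc := accretive_massLocal (d := d) (N' := N') c hκ₁ (diagTerms_isLocal c id hfib_id lamA ℓ X j₀ R) htA
    (fun i => volume_id_cVat (Nf := Nf) one_pos _) μA
  -- the Combes–Thomas smallness of the covariance against `c_V(κ/3)`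
  have hκCm : 8 * kbarPrec c μA lamA ℓ R 0 0 1 ν * kapCov c μA lamA ℓ R (cVat (κ / 3) ν) ν * cVat (κ / 3) ν ≤
      mAcc c μA lamA ℓ R 0 1 ν * 2 := by
    calc 8 * kbarPrec c μA lamA ℓ R 0 0 1 ν * kapCov c μA lamA ℓ R (cVat (κ / 3) ν) ν * cVat (κ / 3) ν
        ≤ 8 * kbarPrec c μA lamA ℓ R 0 0 1 ν *
            (mAcc c μA lamA ℓ R 0 1 ν / (4 * kbarPrec c μA lamA ℓ R 0 0 1 ν * cVat (κ / 3) ν)) * cVat (κ / 3) ν := by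
          gcongr
          exact min_le_right _ _
      _ = mAcc c μA lamA ℓ R 0 1 ν * 2 := by
          field_simp
          ring
  exact NodeOLettersOfWalks.termLetters_of_walks₂
    (modelKernels (d := d) (N' := N') Nf c X j₀ ℓ t
      (massLocal Nf μP (hopTerms Nf Sum.inl Sum.inr tP ℓ X j₀)) (im_massHop_zero Sum.inl Sum.inr μP tP ℓ X j₀)
      hμA (abs_lt_of_mAcc_pos c hκ₁ ℓ hR.le le_rfl le_rfl hmA))
    hX (hopTerms (d := d) (N' := N') Nf id Sum.inr t ℓ X j₀).kernel
    (massLocal (d := d) (N' := N') Nf μP (hopTerms Nf Sum.inl Sum.inr tP ℓ X j₀)) (fun σ u => rfl) hR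
    hJL (by norm_num) (by norm_num)
    hJP (by norm_num) one_pos hmP hPacc
    hJA (by norm_num) (by norm_num) hmA hAacc
    (cV₀ := cVat (1 / 2) ν) (η := κ / 3) (cV := cVat (κ / 3) ν) (Rσ := 0)
    (fun i => (volume_two_cVat (Nf := Nf) (by norm_num) _).1) hη.le hcVη.le
    (fun i => (volume_two_cVat (Nf := Nf) hη _).1) (fun j => (volume_two_cVat (Nf := Nf) hη _).2)
    (fun i => (volume_two_cVat (Nf := Nf) hη _).1) (fun i => volume_id_cVat (Nf := Nf) hη _)
    (fun b z _ => tdist1_nonneg _ _)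
    (κ := κ) (θ' := 2 * κ / 3) (ρL := 2 * κ / 3) (ρE := 2)
    (κC := kapCov c μA lamA ℓ R (cVat (κ / 3) ν) ν) (ρ₀ := 2 * κ / 3) (ρ' := κ / 3)
    hκpos.le (by linarith) hκm.le
    (by positivity) (by linarith) (by linarith)
    (by linarith) (by linarith)
    (by norm_num) (by norm_num) (by norm_num) (by linarith)
    hκC.le (min_le_left _ _ |>.trans (by norm_num)) hκCm
    hη.le (by linarith) le_rfl le_rfl (by linarith)

/-- **In both witnesses every σ-carrying sub-family is NON-EMPTY and the kernels DEPEND on `σ` and `u`** (`x₀ ∈ X`, a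
direction `k`): the hopping terms `(x₀, k)` of `L` and of `H_P`, the diagonal terms of `D_P` at `inl x₀`, `inr x₀` and of
`D_A` at `x₀` carry `σ_{j₀}` (so the letter (L2) ∕ the `through X` mechanism of (3.154) is exercised), and by
`diagTerms_kernel` the diagonal entries are `μ + σ_{j₀}λ(1 + ℓ(u))` on `X`, `μ + λ(1 + ℓ(u))` off `X`.
[cite: Balaban1988RG2Cluster, (1.11) p.5, p.13; Balaban1985BackgroundPropagators, (3.154) p.427] -/
theorem sigmaCarrying_model_nonempty {X : Finset (UT Nf)} {x₀ : UT Nf} (hx₀ : x₀ ∈ X) (k : Fin ν) (t tP lamP lamA : ℝ)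
    (ℓ : E →L[ℂ] ℂ) (j₀ : TPt d N') :
    (x₀, k) ∈ (hopTerms (d := d) (N' := N') Nf id (Sum.inr : UT Nf → UT Nf ⊕ UT Nf) t ℓ X j₀).sigmaCarrying ∧
      (x₀, k) ∈ (hopTerms (d := d) (N' := N') Nf (Sum.inl : UT Nf → UT Nf ⊕ UT Nf) (Sum.inr : UT Nf → UT Nf ⊕ UT Nf)
        tP ℓ X j₀).sigmaCarrying ∧
      (Sum.inl x₀ : UT Nf ⊕ UT Nf) ∈ (diagTerms (d := d) (N' := N') Nf (Sum.elim id id) lamP ℓ X j₀).sigmaCarrying ∧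
      (Sum.inr x₀ : UT Nf ⊕ UT Nf) ∈ (diagTerms (d := d) (N' := N') Nf (Sum.elim id id) lamP ℓ X j₀).sigmaCarrying ∧
      x₀ ∈ (diagTerms (d := d) (N' := N') Nf id lamA ℓ X j₀).sigmaCarrying :=
  ⟨sigmaCarrying_hop_nonempty _ _ t ℓ j₀ hx₀, sigmaCarrying_hop_nonempty _ _ tP ℓ j₀ hx₀,
    sigmaCarrying_diag_nonempty _ lamP ℓ j₀ (by simpa using hx₀),
    sigmaCarrying_diag_nonempty _ lamP ℓ j₀ (by simpa using hx₀), sigmaCarrying_diag_nonempty _ lamA ℓ j₀ hx₀⟩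

end WitnessTwo

end Literature.MathematicalPhysics.QuantumFieldTheory.Balaban1983to89.NodeOLettersOfWalksWitness

end
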